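import Literature.Geometry.Lorentzian.KerrNullRadialPotential
import Literature.Geometry.Lorentzian.SpacetimeLocalConvergence
import Literature.Geometry.Lorentzian.CoordScalarCurvatureEvolution
import Literature.Geometry.Lorentzian.CoordEntropyFormula
import Literature.Geometry.Lorentzian.KerrSchildCoord
import Literature.Geometry.Lorentzian.SpacetimeMetricInCoordsCalculus
import Literature.Geometry.Lorentzian.CoordScalarJet
import Summits.FinalStateConjecture.FinalStateConjecture.Theorems.BartnikGapSettlingGapExhaustionCylindersBendInwardOf
import Summits.FinalStateConjecture.FinalStateConjecture.Theorems.BartnikGapSettlingGapExhaustionCylindersExactMargin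
import Summits.FinalStateConjecture.FinalStateConjecture.Theorems.BartnikGapSettlingGapExhaustionHessMarginStable
import HarnessLib

/-!
# `KerrCylindersBendOutward`: the outward glue (B-out) → (C) → time-uniform outward bending
(crux `GapExhaustion`, stmt-FinalStateConjecture-10808, line photon-shell-pseudoconvexity;
sub-stub (O-E), the outward companion of the inward glue (E)
`stub_kerrCylindersBendInward_of` — the hypersurface condition consumed by the line's inward
sweep S3 from the far zone down to `r_ph⁻ + ε`)

Given

* (B-out) the exact-Kerr OUTWARD margin: on a radial band
  `r_ph⁻ = Kerr.photonOrbitRadius M |a| < r_lo ≤ r ≤ r_e` of the Kerr–Schild chart the coordinate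
  Hessian of the Kerr–Schild radius `r` with respect to the Kerr–Schild components `g_{M,a}` is
  `≥ m‖w‖²` on null vectors tangent to the cylinders `{r = c}` (at all times `x⁰`;
  `kerrCylindersExactMarginOut`), and
* (C) the generic `C¹`-stability of a NEGATIVE Hessian margin over a compact set under a
  `δ`-perturbation of the `1`-jet of the components at the point (`stub_hessMarginStable`),

we deduce the time-uniform outward statement for every spacetime chart on `{M < r}` whose
pulled-back components (`Spacetime.metricInCoords`) are `δ`-close in `C²` sup norm (`supCkENorm`)
to `g_{M,a}` on the band: apply (C) to `f = −r` (the coordinate Hessian is linear in the function,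
`MetricCoord.hessAt_neg`, so `Hess r ≥ m‖w‖²` becomes `Hess (−r) ≤ −m‖w‖²`) on the compact time
slice `{x⁰ = 0, r_lo ≤ r ≤ r_e}` and transport to arbitrary times by the stationarity of Kerr and
the naturality of the coordinate Hessian under translations, verbatim as in the inward glue
(`kerrCylindersBendInward_hessAt_comp_add_right`).
-/

noncomputable section

-- instance search through the nested operator types `E4 →L[ℝ] E4 →L[ℝ] E4 →L[ℝ] ℝ`
set_option maxSynthPendingDepth 3

-- D-0017: single-problem summit, `Summit.<S>.<S>.…` by design (cf. lakefile `weak.linter.dupNamespace`).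
set_option linter.dupNamespace false

namespace Summit.FinalStateConjecture.FinalStateConjecture.Theorems

open Literature.Geometry.Lorentzian Literature.Geometry.Lorentzian.MetricCoord
open scoped Manifold ContDiff Topology ENNReal

/-- **(O-E) The outward glue `(B-out) → (C) →` time-uniform outward bending beyond `r_ph⁻`.**
From the exact-Kerr outward Hessian margin `m` on the band `r_lo ≤ r ≤ r_e`, `r_lo > r_ph⁻`
(hypothesis (B-out)) and the `C¹`-stability of negative Hessian margins on null tangent vectors
over compact sets (hypothesis (C)), applied on the compact time slice `{x⁰ = 0, r_lo ≤ r ≤ r_e}`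
with `G₀ = g_{M,a}`, `f = −r`, `μ = m/2`: for every spacetime chart `Φ` on `{M < r}` whose
pulled-back components are `δ`-close to `g_{M,a}` in `C²` sup norm on the band, the coordinate
Hessian of `r` is `≥ (m/2)‖w‖²` on null vectors tangent to the cylinders at every band point and
every time — a band point `z` at time `t = z⁰` is translated to the slice (`z = z' + t ∂₀`), the
components are translated along (`y ↦ (Φ^* g)(y + t ∂₀)`), and Kerr is stationary, so the `1`-jets
at `z'` of the translated components relative to `g_{M,a}` are those at `z`, bounded by the sup
norm, while the Hessian is natural under translations and odd in the function. -/
theorem stub_kerrCylindersBendOutward_of :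
    (∀ (M a r_lo r_e : ℝ), 0 < M → |a| < M → Kerr.photonOrbitRadius M |a| < r_lo → r_lo < r_e →
      ∃ m : ℝ, 0 < m ∧ ∀ (z w : E4), r_lo ≤ Kerr.radius a z → Kerr.radius a z ≤ r_e →
        Kerr.bilin M a z w w = 0 → fderiv ℝ (Kerr.radius a) z w = 0 →
        m * ‖w‖ ^ 2 ≤ hessAt (Kerr.bilin M a) (Kerr.radius a) z w w) →
    (∀ (G₀ : E4 → E4 →L[ℝ] E4 →L[ℝ] ℝ) (f : E4 → ℝ) (S : Set E4) (μ : ℝ), IsCompact S → 0 < μ →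
      (∃ U : Set E4, IsOpen U ∧ S ⊆ U ∧ ContDiffOn ℝ 1 G₀ U ∧ ContDiffOn ℝ 2 f U) →
      (∀ x ∈ S, (G₀ x).IsInvertible) →
      (∀ x ∈ S, ∀ w : E4, G₀ x w w = 0 → fderiv ℝ f x w = 0 →
        hessAt G₀ f x w w ≤ -(2 * μ) * ‖w‖ ^ 2) →
      ∃ δ : ℝ, 0 < δ ∧ ∀ x ∈ S, ∀ G : E4 → E4 →L[ℝ] E4 →L[ℝ] ℝ,
        ‖G x - G₀ x‖ ≤ δ → ‖fderiv ℝ G x - fderiv ℝ G₀ x‖ ≤ δ →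
        ∀ w : E4, G x w w = 0 → fderiv ℝ f x w = 0 → hessAt G f x w w ≤ -μ * ‖w‖ ^ 2) →
    (∀ (M a r_lo r_e : ℝ), 0 < M → |a| < M → Kerr.photonOrbitRadius M |a| < r_lo → r_lo < r_e →
      ∃ (δ μ : ℝ), 0 < δ ∧ 0 < μ ∧
      ∀ (𝓢 : Spacetime.{0} 4) (Φ : E4 → 𝓢.carrier),
        ContMDiffOn 𝓘(ℝ, E4) (𝓡 4) ∞ Φ {z | M < Kerr.radius a z} →
        Topology.IsOpenEmbedding ({z : E4 | M < Kerr.radius a z}.restrict Φ) →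
        supCkENorm {z | M < Kerr.radius a z ∧ r_lo ≤ Kerr.radius a z ∧ Kerr.radius a z ≤ r_e} 2
            (fun z => 𝓢.metricInCoords Φ z - Kerr.bilin M a z) ≤ ENNReal.ofReal δ →
        ∀ (z w : E4), r_lo ≤ Kerr.radius a z → Kerr.radius a z ≤ r_e →
          𝓢.metricInCoords Φ z w w = 0 → fderiv ℝ (Kerr.radius a) z w = 0 →
          μ * ‖w‖ ^ 2 ≤ hessAt (𝓢.metricInCoords Φ) (Kerr.radius a) z w w) := by
  intro hB hC M a r_lo r_e hM ha hlo hloe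
  obtain ⟨m, hm, hmargin⟩ := hB M a r_lo r_e hM ha hlo hloe
  -- the band lies beyond the photon orbit: `r ≥ r_lo > r_ph⁻ ≥ 3M > M > 0`
  have h3M : 3 * M ≤ Kerr.photonOrbitRadius M |a| :=
    (Kerr.photonOrbitRadius_mem hM (abs_nonneg a)).1
  have hMlo : M < r_lo := by linarith
  have hlo0 : 0 < r_lo := hM.trans hMlo
  -- negation passes through the differential and the coordinate Hessian
  have hfdneg : ∀ (z w : E4),
      fderiv ℝ (fun y ↦ -Kerr.radius a y) z w = -(fderiv ℝ (Kerr.radius a) z w) := by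
    intro z w
    rw [fderiv_fun_neg, neg_apply]
  have hhessneg : ∀ (G : E4 → E4 →L[ℝ] E4 →L[ℝ] ℝ) (z w : E4),
      hessAt G (fun y ↦ -Kerr.radius a y) z w w = -(hessAt G (Kerr.radius a) z w w) := by
    intro G z w
    rw [hessAt_neg, neg_apply, neg_apply]
  -- the compact time slice of the band, inside the open set `{r > 0}`
  set S : Set E4 := {z | z 0 = 0 ∧ r_lo ≤ Kerr.radius a z ∧ Kerr.radius a z ≤ r_e} with hSdef
  have hS : IsCompact S := kerrCylindersBendInward_isCompact_slice a r_e hlo0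
  have hSpos : ∀ z ∈ S, 0 < Kerr.radius a z := fun z hz ↦ hlo0.trans_le hz.2.1
  have hU : ∃ U : Set E4, IsOpen U ∧ S ⊆ U ∧ ContDiffOn ℝ 1 (Kerr.bilin M a) U ∧
      ContDiffOn ℝ 2 (fun y ↦ -Kerr.radius a y) U :=
    ⟨{z | 0 < Kerr.radius a z}, isOpen_lt continuous_const (Kerr.continuous_radius a), hSpos,
      fun z hz ↦ (Kerr.contDiffAt_bilin M a hz).contDiffWithinAt,
      fun z hz ↦ (Kerr.contDiffAt_radius hz).neg.contDiffWithinAt⟩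
  have hinv : ∀ z ∈ S, (Kerr.bilin M a z).IsInvertible := fun z hz ↦
    isInvertible_of_nondegenerate fun v hv ↦ Kerr.bilin_nondegenerate M a (hSpos z hz) v hv
  have h2m : (2 : ℝ) * (m / 2) = m := by ring
  have hmarginS : ∀ z ∈ S, ∀ w : E4, Kerr.bilin M a z w w = 0 →
      fderiv ℝ (fun y ↦ -Kerr.radius a y) z w = 0 →
      hessAt (Kerr.bilin M a) (fun y ↦ -Kerr.radius a y) z w w ≤ -(2 * (m / 2)) * ‖w‖ ^ 2 := by
    intro z hz w hnull hdr
    rw [hfdneg, neg_eq_zero] at hdr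
    rw [h2m, hhessneg]
    have h := hmargin z w hz.2.1 hz.2.2 hnull hdr
    linarith
  obtain ⟨δ, hδ, hstab⟩ :=
    hC (Kerr.bilin M a) (fun y ↦ -Kerr.radius a y) S (m / 2) hS (half_pos hm) hU hinv hmarginS
  refine ⟨δ, m / 2, hδ, half_pos hm, ?_⟩
  intro 𝓢 Φ hΦ _hemb hsup z w hzlo hze hnull hdr
  -- smoothness of the pulled-back components on the open chart domain `{M < r}`, and of `g_{M,a}`
  have hO : IsOpen {z : E4 | M < Kerr.radius a z} :=
    isOpen_lt continuous_const (Kerr.continuous_radius a)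
  have hz : z ∈ {z : E4 | M < Kerr.radius a z} := hMlo.trans_le hzlo
  have hGdiff : DifferentiableAt ℝ (𝓢.metricInCoords Φ) z :=
    (((𝓢.contDiffOn_metricInCoords hO hΦ) z hz).contDiffAt (hO.mem_nhds hz)).differentiableAt
      (by simp)
  have hzpos : 0 < Kerr.radius a z := hlo0.trans_le hzlo
  have hKdiff : DifferentiableAt ℝ (Kerr.bilin M a) z :=
    (Kerr.contDiffAt_bilin M a hzpos (n := 1)).differentiableAt one_ne_zero
  -- pointwise `C¹`-closeness at `z` from the `C²` sup norm over the band
  have hzK : z ∈ {z : E4 | M < Kerr.radius a z ∧ r_lo ≤ Kerr.radius a z ∧ Kerr.radius a z ≤ r_e} :=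
    ⟨hz, hzlo, hze⟩
  have hjet : ∀ k ≤ 2,
      ‖iteratedFDeriv ℝ k (fun z ↦ 𝓢.metricInCoords Φ z - Kerr.bilin M a z) z‖ ≤ δ := by
    intro k hk
    have h := (enorm_iteratedFDeriv_le_supCkENorm hk hzK
      (fun z ↦ 𝓢.metricInCoords Φ z - Kerr.bilin M a z)).trans hsup
    rwa [← ofReal_norm, ENNReal.ofReal_le_ofReal_iff hδ.le] at h
  have hd0 : ‖𝓢.metricInCoords Φ z - Kerr.bilin M a z‖ ≤ δ := by
    have h := hjet 0 (by norm_num)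
    rwa [norm_iteratedFDeriv_zero] at h
  have hd1 : ‖fderiv ℝ (𝓢.metricInCoords Φ) z - fderiv ℝ (Kerr.bilin M a) z‖ ≤ δ := by
    have h := hjet 1 (by norm_num)
    rwa [norm_iteratedFDeriv_one, fderiv_fun_sub hGdiff hKdiff] at h
  -- translate `z` to the time slice: `z = z' + t ∂₀`, `t = z⁰`
  obtain ⟨t, ht⟩ : ∃ t : ℝ, z 0 = t := ⟨_, rfl⟩
  obtain ⟨z', hz'z⟩ : ∃ z' : E4, z' + t • E4.basisVector 0 = z :=
    ⟨z - t • E4.basisVector 0, sub_add_cancel z _⟩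
  have hz'0 : z' 0 = 0 := by
    have h : (z' + t • E4.basisVector 0) 0 = z 0 := by rw [hz'z]
    rw [ht] at h
    simpa [E4.basisVector] using h
  -- stationarity of Kerr: the radius, the components and their first derivatives agree
  have hradfun : (fun y : E4 ↦ Kerr.radius a (y + t • E4.basisVector 0)) = Kerr.radius a :=
    funext fun y ↦ Kerr.radius_add_time_smul_basisVector a y t
  have hbilfun : (fun y : E4 ↦ Kerr.bilin M a (y + t • E4.basisVector 0)) = Kerr.bilin M a :=
    funext fun y ↦ Kerr.bilin_add_smul_basisVector_zero M a y t
  have hrad' : Kerr.radius a z' = Kerr.radius a z := by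
    rw [← hz'z, Kerr.radius_add_time_smul_basisVector]
  have hbil' : Kerr.bilin M a z' = Kerr.bilin M a z := by
    rw [← hz'z, Kerr.bilin_add_smul_basisVector_zero]
  have hfdrad' : fderiv ℝ (Kerr.radius a) z' = fderiv ℝ (Kerr.radius a) z := by
    rw [← hz'z, ← fderiv_comp_add_right (t • E4.basisVector 0)]
    exact (congrArg (fun g : E4 → ℝ ↦ fderiv ℝ g z') hradfun).symm
  have hfdbil' : fderiv ℝ (Kerr.bilin M a) z' = fderiv ℝ (Kerr.bilin M a) z := by
    rw [← hz'z, ← fderiv_comp_add_right (t • E4.basisVector 0)]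
    exact (congrArg (fun g : E4 → E4 →L[ℝ] E4 →L[ℝ] ℝ ↦ fderiv ℝ g z') hbilfun).symm
  have hz'S : z' ∈ S := by
    rw [hSdef]
    exact ⟨hz'0, hzlo.trans_eq hrad'.symm, hrad'.trans_le hze⟩
  -- the translated components `y ↦ (Φ^* g)(y + t ∂₀)` and the naturality of the Hessian
  have hGt1 : fderiv ℝ (fun y ↦ 𝓢.metricInCoords Φ (y + t • E4.basisVector 0)) z' =
      fderiv ℝ (𝓢.metricInCoords Φ) z := by
    rw [fderiv_comp_add_right, hz'z]
  have hH : hessAt (fun y ↦ 𝓢.metricInCoords Φ (y + t • E4.basisVector 0)) (Kerr.radius a) z' =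
      hessAt (𝓢.metricInCoords Φ) (Kerr.radius a) z := by
    have h := kerrCylindersBendInward_hessAt_comp_add_right (𝓢.metricInCoords Φ) (Kerr.radius a)
      (t • E4.basisVector 0) z'
    rw [hradfun, hz'z] at h
    exact h
  have key := hstab z' hz'S (fun y ↦ 𝓢.metricInCoords Φ (y + t • E4.basisVector 0))
    (by
      show ‖𝓢.metricInCoords Φ (z' + t • E4.basisVector 0) - Kerr.bilin M a z'‖ ≤ δ
      rw [hz'z, hbil']
      exact hd0)
    (by
      rw [hGt1, hfdbil']
      exact hd1)
    w
    (by
      show 𝓢.metricInCoords Φ (z' + t • E4.basisVector 0) w w = 0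
      rw [hz'z]
      exact hnull)
    (by
      rw [hfdneg, hfdrad', hdr, neg_zero])
  rw [hhessneg, hH] at key
  linarith

/-- **`KerrCylindersBendOutwardKS` (closed form): time-uniform, `C²`-stable outward bending of the
Kerr cylinders beyond the outer photon orbit `r_ph⁻`, over arbitrary spacetime charts.** For
`0 < M`, `|a| < M` and a band `r_ph⁻ < r_lo < r_e` there are `δ, μ > 0` such that for every
spacetime chart `Φ` on `{M < r}` whose pulled-back components are `δ`-close to `g_{M,a}` in `C²`
sup norm on the band, `Hess r (w, w) ≥ μ‖w‖²` for every vector `w` null for `Φ^* g` and tangent to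
the cylinder through any band point (the hypersurface condition of the inward sweep S3) — the glue
`stub_kerrCylindersBendOutward_of` fed with the exact margin `kerrCylindersExactMarginOut` and the
`C¹`-stability `stub_hessMarginStable`. -/
theorem kerrCylindersBendOutwardKS :
    ∀ (M a r_lo r_e : ℝ), 0 < M → |a| < M → Kerr.photonOrbitRadius M |a| < r_lo → r_lo < r_e →
      ∃ (δ μ : ℝ), 0 < δ ∧ 0 < μ ∧
      ∀ (𝓢 : Spacetime.{0} 4) (Φ : E4 → 𝓢.carrier),
        ContMDiffOn 𝓘(ℝ, E4) (𝓡 4) ∞ Φ {z | M < Kerr.radius a z} →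
        Topology.IsOpenEmbedding ({z : E4 | M < Kerr.radius a z}.restrict Φ) →
        supCkENorm {z | M < Kerr.radius a z ∧ r_lo ≤ Kerr.radius a z ∧ Kerr.radius a z ≤ r_e} 2
            (fun z => 𝓢.metricInCoords Φ z - Kerr.bilin M a z) ≤ ENNReal.ofReal δ →
        ∀ (z w : E4), r_lo ≤ Kerr.radius a z → Kerr.radius a z ≤ r_e →
          𝓢.metricInCoords Φ z w w = 0 → fderiv ℝ (Kerr.radius a) z w = 0 →
          μ * ‖w‖ ^ 2 ≤ hessAt (𝓢.metricInCoords Φ) (Kerr.radius a) z w w :=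
  stub_kerrCylindersBendOutward_of kerrCylindersExactMarginOut stub_hessMarginStable

end Summit.FinalStateConjecture.FinalStateConjecture.Theorems

end
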